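import Summits.BirchSwinnertonDyer.BirchSwinnertonDyer.Theorems.PrintCf2RubinValueTwoKatzMeasureJZeroSeamPerUnit
import Literature.NumberTheory.EllipticCurves.DeShalitThetaTExpansionColemanBridge
import HarnessLib

/-!
# The per-unit `hX` of the `j = 0` seam for a FAMILY of units with ONE constant `A = φ_F(a)^{k+1}` (de Shalit II §4.10 (26) for every unit of
# the class sum II §4.14 (38), assembled — proofs only)

Cell `bsd-print-cf2`, width seat `bsd-line-cf2-p1-w2` g25 (piece (β)-FAM); `--supports` the print leaf stmt-BirchSwinnertonDyer-24720
(helper, Theses-free).  THEOREMS ONLY; no `def`, no named fact, no `sorry`.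

SOCKET FINDING F1 (this seat, 2026-08-30): `KatzMeasureJZeroSeam.twist_mul_integral_eq_of_perUnit` takes ONE constant `A : ℂ₂` in its
per-unit hypotheses `hX`/`hΦ` for ALL units of both label families of the class sum, and (β)
`map_relCoatesWiles_eq_of_bridge` delivers `A = φ_F(a)^{k+1}` from the Tate unit `a` of the bridge identity (hβ); the division-point bridge
`exists_unit_relColemanSeries_eq_subst_subst_of_divisionPoints` (brick B10b) binds `a` under `∃` PER UNIT.  Since the unit `a` of
`exists_unit_forall_ptOfZ_hom_hom_cohPt_eq` (brick B10a) depends only on the torsion points `U_m = ι_v ξ(u_{m+1})` (base point, lattice, `ψ(𝔭)`)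
and not on the ideal indexing the unit, the right statement is `∃ a, ∀ units`.  This file gives the seam-facing forms:

* ★ `map_relCoatesWiles_eq_of_bridge_series` / ★ `map_frob_relCoatesWiles_eq_of_bridge_series` — (β)/(γ) with `G ∈ 𝒪_E⟦X⟧` a plain series
  (its unit structure is DERIVED from (hβ): `g_β` is a unit and `[1]_{P′,f}`, `[a]_f` have no constant term);
* ★★★ `exists_unit_forall_map_relCoatesWiles_eq_of_divisionPoints` — for the lane datum at `v ∣ 2` of degree one with the Lubin–Tate structure
  of the curve's formal group (`V̂ = F_P`, `hP : P ↦ exp_V(c·log_V)`, `2 = ϖc`), de Shalit's SHARED division points `U_m` on the lane curve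
  (kernel, order `2^{m+1}`, `[π]`-coherent, chart identity at the base point `τ^{m+1}(x₀, y₀)`), the SHARED readings (`ψ_𝔓 : R → 𝒪_E` with
  semiconjugating `τ`, `ρ : 𝒪_E → ℂ₂` over `φ_F`, `φ_ℂ : R → ℂ`, `ρ ∘ ψ_𝔓 = ι⁻¹ ∘ φ_ℂ`, the model identities) and a family of units `β j`
  presented by algebraic theta `t`-expansions `G j = ψ_𝔓(Q_R(x₀, y₀; x j; K j))` with complex data `(L, L′ j, S j, Ω)` and levelwise value
  identities: **`∃ a ∈ 𝒪_Fˣ, ∀ j k, ρ(c_{β j, k}) = φ_F(a)^{k+1} · ι⁻¹(−12·(#S_j·E_{k+1}(Ω, L) − E_{k+1}(Ω, L′_j)))`** — `hX` with ONE `A`.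

HONEST FRAMING: an assembly of accepted kernel theorems (B10a, V1+V2, (β), (γ)); the shared/per-unit hypotheses are named, not discharged;
nothing closes a crux; no summit statement is proved; BSD is not proved by any of this.

## References
* [deShalit1987] E. de Shalit, *Iwasawa theory of elliptic curves with complex multiplication* (1987), II §4.4 (iv), (12) (p. 57), II §4.9 (i)(ii)
  (p. 62–63), II §4.10 (26) (p. 64), II §4.14 (38) (p. 71).
-/

-- the summit namespace `Summit.BirchSwinnertonDyer.BirchSwinnertonDyer` repeats the problem name by design (D-0017)
set_option linter.dupNamespace false
set_option autoImplicit false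

noncomputable section

open scoped Classical
open PowerSeries IsDedekindDomain NumberField ValuativeRel Field PeriodPair
open Literature.NumberTheory.NumberFields Literature.NumberTheory.EllipticCurves
open Literature.NumberTheory.GaloisRepresentations Literature.NumberTheory.GaloisRepresentations.IsNonarchimedeanLocalField
  Literature.NumberTheory.GaloisRepresentations.LubinTate Literature.NumberTheory.EllipticCurves.FormalGroupChart

namespace Summit.BirchSwinnertonDyer.BirchSwinnertonDyer.Theorems.PrintCf2.KatzMeasureJZeroSeam

attribute [local instance] ltNormUniformSpace ltNormIsUniformAddGroup rk1 nF nE fintypeResidueField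

/-- `(G ∘ H)(0)` is a unit iff `G(0)` is, when `H(0) = 0` (any commutative ring). [folklore] -/
private theorem isUnit_constantCoeff_of_subst {A : Type*} [CommRing A] {H : PowerSeries A}
    (hH : PowerSeries.constantCoeff H = 0) {G : PowerSeries A} (hG : IsUnit (PowerSeries.constantCoeff (G.subst H))) :
    IsUnit (PowerSeries.constantCoeff G) := by
  have hs : PowerSeries.HasSubst H := PowerSeries.HasSubst.of_constantCoeff_zero' hH
  have h := PowerSeries.constantCoeff_subst hs G
  rw [finsum_eq_single _ 0 (fun d hd => by
    rw [map_pow, show MvPowerSeries.constantCoeff H = PowerSeries.constantCoeff H from rfl, hH, zero_pow hd,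
      smul_zero])] at h
  rw [pow_zero, map_one, PowerSeries.coeff_zero_eq_constantCoeff, smul_eq_mul, mul_one] at h
  have h' : PowerSeries.constantCoeff (G.subst H) = PowerSeries.constantCoeff G := h
  rwa [h'] at hG

variable (K : Type) [Field K] [NumberField K] (v : HeightOneSpectrum (𝓞 K)) [v.asIdeal.LiesOver (ratPlace 2).asIdeal]
  (he : v.asIdeal.ramificationIdx (𝓞 ℚ) = 1) (hf : v.asIdeal.inertiaDeg (𝓞 ℚ) = 1)

set_option maxHeartbeats 1600000 in
/-- ★ **(β) for a plain series `G`**: `map_relCoatesWiles_eq_of_bridge` with `G ∈ 𝒪_E⟦X⟧` (not a unit of the statement; `G` is a unit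
BECAUSE `g_β = (G ∘ [1]_{P′,f}) ∘ [a]_f` is one).  Conclusion: `ρ([X⁰] D_E^[k] (δ_E g_β)) = φ_F(a)^{k+1} · ι⁻¹(−12·(#S·E_{k+1}(Ω, L) − E_{k+1}(Ω, L′)))`.
[cite: deShalit1987, II §4.9 Proposition (i)(ii) (p. 62–63), II §4.10 (26) (p. 64)] -/
theorem map_relCoatesWiles_eq_of_bridge_series
    (hq : residueFieldCard (v.adicCompletion K) = 2)
    (h2 : (valuation (v.adicCompletion K)).IsUniformizer ((((2 : ℕ) : 𝒪[v.adicCompletion K]) : v.adicCompletion K)))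
    (u : 𝒪[v.adicCompletion K]ˣ)
    (E : IntermediateField (v.adicCompletion K) (AlgebraicClosure (v.adicCompletion K)))
    [FiniteDimensional (v.adicCompletion K) E] [Normal (v.adicCompletion K) E] [IsGalois (v.adicCompletion K) E]
    (hE : E ≤ maxUnramified (v.adicCompletion K))
    {σ₀ : absoluteGaloisGroup (v.adicCompletion K)} (hσ₀ : IsAbsArithFrob σ₀)
    (β : RelNormCoherentUnits (isUniformizer_unit_mul h2 u) E) (k : ℕ)
    (ρ : unitBall E →+* ℂ_[2]) (φF : v.adicCompletion K →+* ℂ_[2])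
    (hρ : ρ.comp (algebraMap (LTCoeff (v.adicCompletion K)) (unitBall E)) =
      φF.comp ((algebraMap 𝒪[v.adicCompletion K] (v.adicCompletion K)).comp (LTCoeff.of (v.adicCompletion K)).symm.toRingHom))
    (ιp : PadicAlgCl 2 ≃+* ℂ)
    (V : WeierstrassCurve ℤ_[2]) {c : ℤ_[2]} {P : PowerSeries ℤ_[2]}
    (hP : P.map PadicInt.Coe.ringHom =
      (V.map PadicInt.Coe.ringHom).formalExp.subst (C (c : ℚ_[2]) * (V.map PadicInt.Coe.ringHom).formalLog))
    (heπ : ((integerEquivAdicCompletionIntegers v).trans (padicIntEquivOfDegreeOne K 2 v he hf))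
      ((u : 𝒪[v.adicCompletion K]) * ((2 : ℕ) : 𝒪[v.adicCompletion K])) = c)
    (hP' : IsLTSeries (LTCoeff.of (v.adicCompletion K) ((u : 𝒪[v.adicCompletion K]) * ((2 : ℕ) : 𝒪[v.adicCompletion K])))
      (residueFieldCard (v.adicCompletion K))
      (P.map ((LTCoeff.of (v.adicCompletion K)).toRingHom.comp
        ((integerEquivAdicCompletionIntegers v).trans (padicIntEquivOfDegreeOne K 2 v he hf)).symm.toRingHom)))
    (a : LTCoeff (v.adicCompletion K)) (G : PowerSeries (unitBall E))
    (hβ : relColemanSeries (isUniformizer_unit_mul h2 u) E hq hE hσ₀ β =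
      PowerSeries.subst ((hom (isLTRing_LTCoeff (isUniformizer_unit_mul h2 u)) (isLTSeries_LTCoeff _) (isLTSeries_LTCoeff _) a).map
          (algebraMap (LTCoeff (v.adicCompletion K)) (unitBall E)))
        (PowerSeries.subst ((hom (isLTRing_LTCoeff (isUniformizer_unit_mul h2 u)) hP' (isLTSeries_LTCoeff _) 1).map
          (algebraMap (LTCoeff (v.adicCompletion K)) (unitBall E))) G))
    {R : Type*} [CommRing R] (WR : WeierstrassCurve R) (x₀ y₀ : R) (x : ℂ → R) (uc : ℂ → Rˣ) (Kc : R) (φC : R →+* ℂ)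
    (WC : WeierstrassCurve ℂ) (L : PeriodPair) {L' : PeriodPair} {S : Finset ℂ} {Ω : ℂ}
    (hS : L.IsLatticeReps L' S) (hg₂ : L.g₂ = WC.c₄ / 12) (hg₃ : L.g₃ = WC.c₆ / 216) (hΩ : Ω ∉ L'.lattice) (hV : WR.map φC = WC)
    (ha : φC x₀ = ℘[L] Ω - WC.b₂ / 12) (hb : φC y₀ = (℘'[L] Ω - WC.a₁ * (℘[L] Ω - WC.b₂ / 12) - WC.a₃) / 2)
    (hK : φC Kc = L.deltaRatio L' * (L.g₂ ^ 3 - 27 * L.g₃ ^ 2) ^ (S.card - 1))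
    (hx : ∀ c ∈ S.erase 0, φC (x c) = ℘[L] c - WC.b₂ / 12) (hu : ∀ c ∈ S.erase 0, (uc c : R) = x₀ - x c)
    (ψ𝔓 : R →+* unitBall E)
    (hG : G = PowerSeries.map ψ𝔓 (C Kc * ∏ c ∈ S.erase 0,
        PowerSeries.invOfUnit ((WR.translateX x₀ y₀).subst WR.formalNeg - C (x c)) (uc c) ^ 6))
    (hQθ : ρ.comp ψ𝔓 = ((algebraMap (PadicAlgCl 2) ℂ_[2]).comp ιp.symm.toRingHom).comp φC)
    (hW : (WR.map φC).map ((algebraMap (PadicAlgCl 2) ℂ_[2]).comp ιp.symm.toRingHom) =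
      (V.map (((padicEquivOfDegreeOne K 2 v he hf).symm.toRingHom).comp (PadicInt.Coe.ringHom (p := 2)))).map φF) :
    ρ (PowerSeries.constantCoeff ((fun g : PowerSeries (unitBall E) =>
        (invDiff (isLTRing_LTCoeff (isUniformizer_unit_mul h2 u))
            (isLTSeries_LTCoeff ((u : 𝒪[v.adicCompletion K]) * ((2 : ℕ) : 𝒪[v.adicCompletion K])))).map
            (algebraMap (LTCoeff (v.adicCompletion K)) (unitBall E)) *
          PowerSeries.derivative (unitBall E) g)^[k] (relLogDerivSeries (isUniformizer_unit_mul h2 u) E hq hE hσ₀ β))) =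
      (φF (((LTCoeff.of (v.adicCompletion K)).symm a : 𝒪[v.adicCompletion K]) : v.adicCompletion K)) ^ (k + 1) *
        ((ιp.symm (-12 * ((S.card : ℂ) * L.eisensteinE (k + 1) Ω - L'.eisensteinE (k + 1) Ω)) : PadicAlgCl 2) : ℂ_[2]) := by
  -- `G` is a unit: `g_β(0) = G(0)` (the two substituted series have no constant term) and `g_β` is a unit
  have h0a : PowerSeries.constantCoeff ((hom (isLTRing_LTCoeff (isUniformizer_unit_mul h2 u)) (isLTSeries_LTCoeff _)
      (isLTSeries_LTCoeff _) a).map (algebraMap (LTCoeff (v.adicCompletion K)) (unitBall E))) = 0 := by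
    rw [← PowerSeries.coeff_zero_eq_constantCoeff_apply, PowerSeries.coeff_map, PowerSeries.coeff_zero_eq_constantCoeff_apply,
      constantCoeff_hom, map_zero]
  have h01 : PowerSeries.constantCoeff ((hom (isLTRing_LTCoeff (isUniformizer_unit_mul h2 u)) hP' (isLTSeries_LTCoeff _) 1).map
      (algebraMap (LTCoeff (v.adicCompletion K)) (unitBall E))) = 0 := by
    rw [← PowerSeries.coeff_zero_eq_constantCoeff_apply, PowerSeries.coeff_map, PowerSeries.coeff_zero_eq_constantCoeff_apply,
      constantCoeff_hom, map_zero]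
  have hGu : IsUnit G := by
    rw [PowerSeries.isUnit_iff_constantCoeff]
    have h := isUnit_constantCoeff_relColemanSeries (isUniformizer_unit_mul h2 u) E hq hE hσ₀ β
    rw [hβ] at h
    exact isUnit_constantCoeff_of_subst h01 (isUnit_constantCoeff_of_subst h0a h)
  exact map_relCoatesWiles_eq_of_bridge K v he hf hq h2 u E hE hσ₀ β k ρ φF hρ ιp V hP heπ hP' a hGu.unit
    (by rw [IsUnit.unit_spec]; exact hβ) WR x₀ y₀ x uc Kc φC WC L hS hg₂ hg₃ hΩ hV ha hb hK hx hu ψ𝔓 (by rw [IsUnit.unit_spec]; exact hG)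
    hQθ hW

set_option maxHeartbeats 1600000 in
/-- ★ **(γ) for a plain series `G`**: `map_frob_relCoatesWiles_eq_of_bridge` with `G ∈ 𝒪_E⟦X⟧` (unit structure derived from (hβ)) and the
conjugate presentation (hGφ) `G^φ = Q_R^{ψ_𝔓}`.  Conclusion: `ρ(φ([X⁰] D_E^[k] (δ_E g_β))) = φ_F(a)^{k+1} · ι⁻¹(−12·(#S·E_{k+1}(Ω, L) − E_{k+1}(Ω, L′)))`.
[cite: deShalit1987, II §4.5 (iv) (p. 57), II §4.10 (26) (p. 64), II §4.14 (38) (p. 71)] -/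
theorem map_frob_relCoatesWiles_eq_of_bridge_series
    (hq : residueFieldCard (v.adicCompletion K) = 2)
    (h2 : (valuation (v.adicCompletion K)).IsUniformizer ((((2 : ℕ) : 𝒪[v.adicCompletion K]) : v.adicCompletion K)))
    (u : 𝒪[v.adicCompletion K]ˣ)
    (E : IntermediateField (v.adicCompletion K) (AlgebraicClosure (v.adicCompletion K)))
    [FiniteDimensional (v.adicCompletion K) E] [Normal (v.adicCompletion K) E] [IsGalois (v.adicCompletion K) E]
    (hE : E ≤ maxUnramified (v.adicCompletion K))
    {σ₀ : absoluteGaloisGroup (v.adicCompletion K)} (hσ₀ : IsAbsArithFrob σ₀)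
    (β : RelNormCoherentUnits (isUniformizer_unit_mul h2 u) E) (k : ℕ)
    (ρ : unitBall E →+* ℂ_[2]) (φF : v.adicCompletion K →+* ℂ_[2])
    (hρ : ρ.comp (algebraMap (LTCoeff (v.adicCompletion K)) (unitBall E)) =
      φF.comp ((algebraMap 𝒪[v.adicCompletion K] (v.adicCompletion K)).comp (LTCoeff.of (v.adicCompletion K)).symm.toRingHom))
    (ιp : PadicAlgCl 2 ≃+* ℂ)
    (V : WeierstrassCurve ℤ_[2]) {c : ℤ_[2]} {P : PowerSeries ℤ_[2]}
    (hP : P.map PadicInt.Coe.ringHom =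
      (V.map PadicInt.Coe.ringHom).formalExp.subst (C (c : ℚ_[2]) * (V.map PadicInt.Coe.ringHom).formalLog))
    (heπ : ((integerEquivAdicCompletionIntegers v).trans (padicIntEquivOfDegreeOne K 2 v he hf))
      ((u : 𝒪[v.adicCompletion K]) * ((2 : ℕ) : 𝒪[v.adicCompletion K])) = c)
    (hP' : IsLTSeries (LTCoeff.of (v.adicCompletion K) ((u : 𝒪[v.adicCompletion K]) * ((2 : ℕ) : 𝒪[v.adicCompletion K])))
      (residueFieldCard (v.adicCompletion K))
      (P.map ((LTCoeff.of (v.adicCompletion K)).toRingHom.comp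
        ((integerEquivAdicCompletionIntegers v).trans (padicIntEquivOfDegreeOne K 2 v he hf)).symm.toRingHom)))
    (a : LTCoeff (v.adicCompletion K)) (G : PowerSeries (unitBall E))
    (hβ : relColemanSeries (isUniformizer_unit_mul h2 u) E hq hE hσ₀ β =
      PowerSeries.subst ((hom (isLTRing_LTCoeff (isUniformizer_unit_mul h2 u)) (isLTSeries_LTCoeff _) (isLTSeries_LTCoeff _) a).map
          (algebraMap (LTCoeff (v.adicCompletion K)) (unitBall E)))
        (PowerSeries.subst ((hom (isLTRing_LTCoeff (isUniformizer_unit_mul h2 u)) hP' (isLTSeries_LTCoeff _) 1).map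
          (algebraMap (LTCoeff (v.adicCompletion K)) (unitBall E))) G))
    {R : Type*} [CommRing R] (WR : WeierstrassCurve R) (x₀ y₀ : R) (x : ℂ → R) (uc : ℂ → Rˣ) (Kc : R) (φC : R →+* ℂ)
    (WC : WeierstrassCurve ℂ) (L : PeriodPair) {L' : PeriodPair} {S : Finset ℂ} {Ω : ℂ}
    (hS : L.IsLatticeReps L' S) (hg₂ : L.g₂ = WC.c₄ / 12) (hg₃ : L.g₃ = WC.c₆ / 216) (hΩ : Ω ∉ L'.lattice) (hV : WR.map φC = WC)
    (ha : φC x₀ = ℘[L] Ω - WC.b₂ / 12) (hb : φC y₀ = (℘'[L] Ω - WC.a₁ * (℘[L] Ω - WC.b₂ / 12) - WC.a₃) / 2)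
    (hK : φC Kc = L.deltaRatio L' * (L.g₂ ^ 3 - 27 * L.g₃ ^ 2) ^ (S.card - 1))
    (hx : ∀ c ∈ S.erase 0, φC (x c) = ℘[L] c - WC.b₂ / 12) (hu : ∀ c ∈ S.erase 0, (uc c : R) = x₀ - x c)
    (ψ𝔓 : R →+* unitBall E)
    (hGφ : PowerSeries.map (frobUnitBall E σ₀ : unitBall E →+* unitBall E) G =
      PowerSeries.map ψ𝔓 (C Kc * ∏ c ∈ S.erase 0,
        PowerSeries.invOfUnit ((WR.translateX x₀ y₀).subst WR.formalNeg - C (x c)) (uc c) ^ 6))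
    (hQθ : ρ.comp ψ𝔓 = ((algebraMap (PadicAlgCl 2) ℂ_[2]).comp ιp.symm.toRingHom).comp φC)
    (hW : (WR.map φC).map ((algebraMap (PadicAlgCl 2) ℂ_[2]).comp ιp.symm.toRingHom) =
      (V.map (((padicEquivOfDegreeOne K 2 v he hf).symm.toRingHom).comp (PadicInt.Coe.ringHom (p := 2)))).map φF) :
    ρ ((frobUnitBall E σ₀ : unitBall E →+* unitBall E) (PowerSeries.constantCoeff ((fun g : PowerSeries (unitBall E) =>
        (invDiff (isLTRing_LTCoeff (isUniformizer_unit_mul h2 u))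
            (isLTSeries_LTCoeff ((u : 𝒪[v.adicCompletion K]) * ((2 : ℕ) : 𝒪[v.adicCompletion K])))).map
            (algebraMap (LTCoeff (v.adicCompletion K)) (unitBall E)) *
          PowerSeries.derivative (unitBall E) g)^[k] (relLogDerivSeries (isUniformizer_unit_mul h2 u) E hq hE hσ₀ β)))) =
      (φF (((LTCoeff.of (v.adicCompletion K)).symm a : 𝒪[v.adicCompletion K]) : v.adicCompletion K)) ^ (k + 1) *
        ((ιp.symm (-12 * ((S.card : ℂ) * L.eisensteinE (k + 1) Ω - L'.eisensteinE (k + 1) Ω)) : PadicAlgCl 2) : ℂ_[2]) := by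
  have h0a : PowerSeries.constantCoeff ((hom (isLTRing_LTCoeff (isUniformizer_unit_mul h2 u)) (isLTSeries_LTCoeff _)
      (isLTSeries_LTCoeff _) a).map (algebraMap (LTCoeff (v.adicCompletion K)) (unitBall E))) = 0 := by
    rw [← PowerSeries.coeff_zero_eq_constantCoeff_apply, PowerSeries.coeff_map, PowerSeries.coeff_zero_eq_constantCoeff_apply,
      constantCoeff_hom, map_zero]
  have h01 : PowerSeries.constantCoeff ((hom (isLTRing_LTCoeff (isUniformizer_unit_mul h2 u)) hP' (isLTSeries_LTCoeff _) 1).map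
      (algebraMap (LTCoeff (v.adicCompletion K)) (unitBall E))) = 0 := by
    rw [← PowerSeries.coeff_zero_eq_constantCoeff_apply, PowerSeries.coeff_map, PowerSeries.coeff_zero_eq_constantCoeff_apply,
      constantCoeff_hom, map_zero]
  have hGu : IsUnit G := by
    rw [PowerSeries.isUnit_iff_constantCoeff]
    have h := isUnit_constantCoeff_relColemanSeries (isUniformizer_unit_mul h2 u) E hq hE hσ₀ β
    rw [hβ] at h
    exact isUnit_constantCoeff_of_subst h01 (isUnit_constantCoeff_of_subst h0a h)
  exact map_frob_relCoatesWiles_eq_of_bridge K v he hf hq h2 u E hE hσ₀ β k ρ φF hρ ιp V hP heπ hP' a hGu.unit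
    (by rw [IsUnit.unit_spec]; exact hβ) WR x₀ y₀ x uc Kc φC WC L hS hg₂ hg₃ hΩ hV ha hb hK hx hu ψ𝔓 (by rw [IsUnit.unit_spec]; exact hGφ)
    hQθ hW

set_option maxHeartbeats 1600000 in
/-- ★★★ **`hX` for a FAMILY of units with ONE constant `A = φ_F(a)^{k+1}`** (de Shalit II §4.4 (iv) + §4.9 (ii) + §4.10 (26) for every unit of the
class sum, assembled): in the lane datum at `v ∣ 2` of degree one with the Lubin–Tate structure `V̂ = F_P` of the curve's formal group, GIVEN
de Shalit's SHARED division points `U_m` on the lane curve (kernel, order `2^{m+1}`, `[π]`-coherent) with the chart identity at the base point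
`τ^{m+1}(x₀, y₀)`, the shared readings `ψ_𝔓`, `τ`, `ρ`, `φ_ℂ` and model identities, and for every unit `j` a presentation
`G j = ψ_𝔓(Q_R(x₀, y₀; x j; K j))` with complex data `(L, L′ j, S j, Ω)`, `τ`-symmetry and levelwise value identities:
**`∃ a ∈ 𝒪_Fˣ, ∀ j k, ρ([X⁰] D_E^[k] (δ_E g_{β j})) = φ_F(a)^{k+1} · ι⁻¹(−12·(#(S j)·E_{k+1}(Ω, L) − E_{k+1}(Ω, L′ j)))`**.
[cite: deShalit1987, II §4.4 (iv), (12) (p. 57), II §4.9 Proposition (ii) (p. 63), II §4.10 (26) (p. 64), II §4.14 (38) (p. 71)] -/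
theorem exists_unit_forall_map_relCoatesWiles_eq_of_divisionPoints
    (hq : residueFieldCard (v.adicCompletion K) = 2)
    (h2 : (valuation (v.adicCompletion K)).IsUniformizer ((((2 : ℕ) : 𝒪[v.adicCompletion K]) : v.adicCompletion K)))
    (u : 𝒪[v.adicCompletion K]ˣ)
    (E : IntermediateField (v.adicCompletion K) (AlgebraicClosure (v.adicCompletion K)))
    [FiniteDimensional (v.adicCompletion K) E] [Normal (v.adicCompletion K) E] [IsGalois (v.adicCompletion K) E]
    (hE : E ≤ maxUnramified (v.adicCompletion K))
    {σ₀ : absoluteGaloisGroup (v.adicCompletion K)} (hσ₀ : IsAbsArithFrob σ₀)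
    (ρ : unitBall E →+* ℂ_[2]) (φF : v.adicCompletion K →+* ℂ_[2])
    (hρ : ρ.comp (algebraMap (LTCoeff (v.adicCompletion K)) (unitBall E)) =
      φF.comp ((algebraMap 𝒪[v.adicCompletion K] (v.adicCompletion K)).comp (LTCoeff.of (v.adicCompletion K)).symm.toRingHom))
    (ιp : PadicAlgCl 2 ≃+* ℂ)
    -- the `ℤ₂`-datum of the curve with its Lubin–Tate structure (`cm7Padic_exists_formalGroupLaw_eq_ltF`): `P ↦ exp_V(c·log_V)`, `V̂ = F_P`, `2 = ϖc`
    (V : WeierstrassCurve ℤ_[2]) {c ϖ : ℤ_[2]} {P : PowerSeries ℤ_[2]}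
    (hP : P.map PadicInt.Coe.ringHom =
      (V.map PadicInt.Coe.ringHom).formalExp.subst (C (c : ℚ_[2]) * (V.map PadicInt.Coe.ringHom).formalLog))
    (hA : IsLTRing c 2) (hPlt : IsLTSeries c 2 P) (hVlt : V.formalGroupLaw = ltF hA hPlt) (hp : ((2 : ℕ) : ℤ_[2]) = ϖ * c) (hϖ : IsUnit ϖ)
    (heπ : ((integerEquivAdicCompletionIntegers v).trans (padicIntEquivOfDegreeOne K 2 v he hf))
      ((u : 𝒪[v.adicCompletion K]) * ((2 : ℕ) : 𝒪[v.adicCompletion K])) = c)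
    [hEll : ∀ m : ℕ, (curveOver (E ⊔ ltField ((u : 𝒪[v.adicCompletion K]) * ((2 : ℕ) : 𝒪[v.adicCompletion K])) m :
        IntermediateField (v.adicCompletion K) (AlgebraicClosure (v.adicCompletion K)))
      (V.map ((LTCoeff.of (v.adicCompletion K)).toRingHom.comp
        ((integerEquivAdicCompletionIntegers v).trans (padicIntEquivOfDegreeOne K 2 v he hf)).symm.toRingHom))).IsElliptic]
    -- shared: the `𝔓`-adic reading of the theta data, the model, the semiconjugating endomorphism, the base point, the complex reading
    {R : Type*} [CommRing R] (ψ𝔓 : R →+* unitBall E) (WR : WeierstrassCurve R)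
    (hWR : WR.map ψ𝔓 = (V.map ((LTCoeff.of (v.adicCompletion K)).toRingHom.comp
        ((integerEquivAdicCompletionIntegers v).trans (padicIntEquivOfDegreeOne K 2 v he hf)).symm.toRingHom)).map
      (algebraMap (LTCoeff (v.adicCompletion K)) (unitBall E)))
    (τ : R →+* R) (hτ : ((frobUnitBall E σ₀).symm : unitBall E →+* unitBall E).comp ψ𝔓 = ψ𝔓.comp τ)
    (hWτ : WR.map τ = WR) (x₀ y₀ : R) (φC : R →+* ℂ) (WC : WeierstrassCurve ℂ) (L : PeriodPair) (Ω : ℂ)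
    (hg₂ : L.g₂ = WC.c₄ / 12) (hg₃ : L.g₃ = WC.c₆ / 216) (hV : WR.map φC = WC)
    (ha : φC x₀ = ℘[L] Ω - WC.b₂ / 12) (hb : φC y₀ = (℘'[L] Ω - WC.a₁ * (℘[L] Ω - WC.b₂ / 12) - WC.a₃) / 2)
    (hQθ : ρ.comp ψ𝔓 = ((algebraMap (PadicAlgCl 2) ℂ_[2]).comp ιp.symm.toRingHom).comp φC)
    (hW : (WR.map φC).map ((algebraMap (PadicAlgCl 2) ℂ_[2]).comp ιp.symm.toRingHom) =
      (V.map (((padicEquivOfDegreeOne K 2 v he hf).symm.toRingHom).comp (PadicInt.Coe.ringHom (p := 2)))).map φF)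
    -- shared: de Shalit's division points on the lane curve, levelwise, with the chart identity at `τ^{m+1}(x₀, y₀)`
    (U : ∀ m : ℕ, (curveOver (E ⊔ ltField ((u : 𝒪[v.adicCompletion K]) * ((2 : ℕ) : 𝒪[v.adicCompletion K])) m :
        IntermediateField (v.adicCompletion K) (AlgebraicClosure (v.adicCompletion K)))
      (V.map ((LTCoeff.of (v.adicCompletion K)).toRingHom.comp
        ((integerEquivAdicCompletionIntegers v).trans (padicIntEquivOfDegreeOne K 2 v he hf)).symm.toRingHom))).toAffine.Point)
    (hU : ∀ m : ℕ, U m ∈ kernel (NormedField.valuation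
        (K := (E ⊔ ltField ((u : 𝒪[v.adicCompletion K]) * ((2 : ℕ) : 𝒪[v.adicCompletion K])) m :
          IntermediateField (v.adicCompletion K) (AlgebraicClosure (v.adicCompletion K)))))
      (curveOver (E ⊔ ltField ((u : 𝒪[v.adicCompletion K]) * ((2 : ℕ) : 𝒪[v.adicCompletion K])) m :
          IntermediateField (v.adicCompletion K) (AlgebraicClosure (v.adicCompletion K)))
        (V.map ((LTCoeff.of (v.adicCompletion K)).toRingHom.comp
          ((integerEquivAdicCompletionIntegers v).trans (padicIntEquivOfDegreeOne K 2 v he hf)).symm.toRingHom))))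
    (hord : ∀ m : ℕ, addOrderOf (U m) = 2 ^ (m + 1))
    (hcoh : ∀ m : ℕ, ltSMul (maxNilIdeal (v.adicCompletion K)
          (E ⊔ ltField ((u : 𝒪[v.adicCompletion K]) * ((2 : ℕ) : 𝒪[v.adicCompletion K])) (m + 1) :
            IntermediateField (v.adicCompletion K) (AlgebraicClosure (v.adicCompletion K))))
        (isLTRing_LTCoeff (isUniformizer_unit_mul h2 u))
        (isLTSeries_map_LTCoeff_of_degree_one ((integerEquivAdicCompletionIntegers v).trans (padicIntEquivOfDegreeOne K 2 v he hf))
          hq heπ hPlt)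
        (LTCoeff.of (v.adicCompletion K) ((u : 𝒪[v.adicCompletion K]) * ((2 : ℕ) : 𝒪[v.adicCompletion K])))
        (zPt (U (m + 1)) (hU (m + 1))) =
      inclPt (sup_le_sup_left (ltField_mono (isUniformizer_unit_mul h2 u) (Nat.le_succ m)) E) (zPt (U m) (hU m)))
    (xR yR : (m : ℕ) → ↥(E ⊔ ltField ((u : 𝒪[v.adicCompletion K]) * ((2 : ℕ) : 𝒪[v.adicCompletion K])) m :
      IntermediateField (v.adicCompletion K) (AlgebraicClosure (v.adicCompletion K))))
    (h₀ : ∀ m : ℕ, (curveOver (E ⊔ ltField ((u : 𝒪[v.adicCompletion K]) * ((2 : ℕ) : 𝒪[v.adicCompletion K])) m :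
          IntermediateField (v.adicCompletion K) (AlgebraicClosure (v.adicCompletion K)))
        (V.map ((LTCoeff.of (v.adicCompletion K)).toRingHom.comp
          ((integerEquivAdicCompletionIntegers v).trans (padicIntEquivOfDegreeOne K 2 v he hf)).symm.toRingHom))).toAffine.Nonsingular
      (((inclUnitBall (F := v.adicCompletion K) (le_sup_left : E ≤ E ⊔ ltField _ m) (ψ𝔓 (τ^[m + 1] x₀)) :
        unitBall (E ⊔ ltField ((u : 𝒪[v.adicCompletion K]) * ((2 : ℕ) : 𝒪[v.adicCompletion K])) m :
          IntermediateField (v.adicCompletion K) (AlgebraicClosure (v.adicCompletion K)))) :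
        (E ⊔ ltField ((u : 𝒪[v.adicCompletion K]) * ((2 : ℕ) : 𝒪[v.adicCompletion K])) m : IntermediateField (v.adicCompletion K) _)))
      (((inclUnitBall (F := v.adicCompletion K) (le_sup_left : E ≤ E ⊔ ltField _ m) (ψ𝔓 (τ^[m + 1] y₀)) :
        unitBall (E ⊔ ltField ((u : 𝒪[v.adicCompletion K]) * ((2 : ℕ) : 𝒪[v.adicCompletion K])) m :
          IntermediateField (v.adicCompletion K) (AlgebraicClosure (v.adicCompletion K)))) :
        (E ⊔ ltField ((u : 𝒪[v.adicCompletion K]) * ((2 : ℕ) : 𝒪[v.adicCompletion K])) m : IntermediateField (v.adicCompletion K) _))))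
    (hR : ∀ m : ℕ, (curveOver (E ⊔ ltField ((u : 𝒪[v.adicCompletion K]) * ((2 : ℕ) : 𝒪[v.adicCompletion K])) m :
          IntermediateField (v.adicCompletion K) (AlgebraicClosure (v.adicCompletion K)))
        (V.map ((LTCoeff.of (v.adicCompletion K)).toRingHom.comp
          ((integerEquivAdicCompletionIntegers v).trans (padicIntEquivOfDegreeOne K 2 v he hf)).symm.toRingHom))).toAffine.Nonsingular
      (xR m) (yR m))
    (hpt : ∀ m : ℕ, (.some _ _ (h₀ m) : (curveOver (E ⊔ ltField ((u : 𝒪[v.adicCompletion K]) * ((2 : ℕ) : 𝒪[v.adicCompletion K])) m :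
          IntermediateField (v.adicCompletion K) (AlgebraicClosure (v.adicCompletion K)))
        (V.map ((LTCoeff.of (v.adicCompletion K)).toRingHom.comp
          ((integerEquivAdicCompletionIntegers v).trans (padicIntEquivOfDegreeOne K 2 v he hf)).symm.toRingHom))).toAffine.Point) -
      U m = .some _ _ (hR m))
    -- per unit `j`: the unit, its presentation (complex data `L′ j ⊇ L` with representatives `S j`), its `τ`-symmetry, its values
    {J : Type*} (β : J → RelNormCoherentUnits (isUniformizer_unit_mul h2 u) E) (G : J → PowerSeries (unitBall E))
    (L' : J → PeriodPair) (S : J → Finset ℂ) (hS : ∀ j, L.IsLatticeReps (L' j) (S j)) (hΩ : ∀ j, Ω ∉ (L' j).lattice)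
    (Kc : J → R) (x : J → ℂ → R) (uc : J → ℂ → Rˣ)
    (hK : ∀ j, φC (Kc j) = L.deltaRatio (L' j) * (L.g₂ ^ 3 - 27 * L.g₃ ^ 2) ^ ((S j).card - 1))
    (hx : ∀ j, ∀ c ∈ (S j).erase 0, φC (x j c) = ℘[L] c - WC.b₂ / 12) (hu : ∀ j, ∀ c ∈ (S j).erase 0, (uc j c : R) = x₀ - x j c)
    (hG : ∀ j, G j = PowerSeries.map ψ𝔓 (C (Kc j) * ∏ c ∈ (S j).erase 0,
        PowerSeries.invOfUnit ((WR.translateX x₀ y₀).subst WR.formalNeg - C (x j c)) (uc j c) ^ 6))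
    (hKτ : ∀ j, τ (Kc j) = Kc j) (eι : J → ℂ → ℂ) (heT : ∀ j, ∀ c ∈ (S j).erase 0, eι j c ∈ (S j).erase 0)
    (hinj : ∀ j, Set.InjOn (eι j) ((S j).erase 0)) (hsurj : ∀ j, Set.SurjOn (eι j) ((S j).erase 0) ((S j).erase 0))
    (hxτ : ∀ j, ∀ c ∈ (S j).erase 0, τ (x j c) = x j (eι j c))
    (hval : ∀ (j : J) (m : ℕ), ((inclUnitBall (F := v.adicCompletion K) (le_sup_left : E ≤ E ⊔ ltField _ m) (ψ𝔓 (Kc j)) :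
        unitBall (E ⊔ ltField ((u : 𝒪[v.adicCompletion K]) * ((2 : ℕ) : 𝒪[v.adicCompletion K])) m :
          IntermediateField (v.adicCompletion K) (AlgebraicClosure (v.adicCompletion K)))) :
        (E ⊔ ltField ((u : 𝒪[v.adicCompletion K]) * ((2 : ℕ) : 𝒪[v.adicCompletion K])) m : IntermediateField (v.adicCompletion K) _)) *
        ∏ c ∈ (S j).erase 0, ((xR m - (((inclUnitBall (F := v.adicCompletion K) (le_sup_left : E ≤ E ⊔ ltField _ m) (ψ𝔓 (x j c)) :
          unitBall (E ⊔ ltField ((u : 𝒪[v.adicCompletion K]) * ((2 : ℕ) : 𝒪[v.adicCompletion K])) m :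
            IntermediateField (v.adicCompletion K) (AlgebraicClosure (v.adicCompletion K)))) :
          (E ⊔ ltField ((u : 𝒪[v.adicCompletion K]) * ((2 : ℕ) : 𝒪[v.adicCompletion K])) m : IntermediateField (v.adicCompletion K) _))))⁻¹) ^ 6 =
      (((β j).val m : unitBall (E ⊔ ltField ((u : 𝒪[v.adicCompletion K]) * ((2 : ℕ) : 𝒪[v.adicCompletion K])) m :
          IntermediateField (v.adicCompletion K) (AlgebraicClosure (v.adicCompletion K)))) :
        (E ⊔ ltField ((u : 𝒪[v.adicCompletion K]) * ((2 : ℕ) : 𝒪[v.adicCompletion K])) m : IntermediateField (v.adicCompletion K) _))) :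
    ∃ a : 𝒪[v.adicCompletion K]ˣ, ∀ (j : J) (k : ℕ),
      ρ (PowerSeries.constantCoeff ((fun g : PowerSeries (unitBall E) =>
          (invDiff (isLTRing_LTCoeff (isUniformizer_unit_mul h2 u))
              (isLTSeries_LTCoeff ((u : 𝒪[v.adicCompletion K]) * ((2 : ℕ) : 𝒪[v.adicCompletion K])))).map
              (algebraMap (LTCoeff (v.adicCompletion K)) (unitBall E)) *
            PowerSeries.derivative (unitBall E) g)^[k] (relLogDerivSeries (isUniformizer_unit_mul h2 u) E hq hE hσ₀ (β j)))) =
        (φF ((a : 𝒪[v.adicCompletion K]) : v.adicCompletion K)) ^ (k + 1) *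
          ((ιp.symm (-12 * (((S j).card : ℂ) * L.eisensteinE (k + 1) Ω - (L' j).eisensteinE (k + 1) Ω)) : PadicAlgCl 2) : ℂ_[2]) := by
  -- ONE Tate unit from the shared torsion points (B10a)
  obtain ⟨a, ha'⟩ := exists_unit_forall_ptOfZ_hom_hom_cohPt_eq
    ((integerEquivAdicCompletionIntegers v).trans (padicIntEquivOfDegreeOne K 2 v he hf)) hq (isUniformizer_unit_mul h2 u) heπ hA hPlt
    hVlt hp hϖ E U hU hord hcoh
  -- the parameter `t_m = h([a]_f ω_{m+1})` is non-zero: `P(t_m) = U_m` has order `2^{m+1} ≠ 1`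
  have ht0 : ∀ m : ℕ, (((evalPt₁ (maxNilIdeal (v.adicCompletion K)
      (E ⊔ ltField ((u : 𝒪[v.adicCompletion K]) * ((2 : ℕ) : 𝒪[v.adicCompletion K])) m :
        IntermediateField (v.adicCompletion K) (AlgebraicClosure (v.adicCompletion K))))
      (hom (isLTRing_LTCoeff (isUniformizer_unit_mul h2 u))
        (isLTSeries_map_LTCoeff_of_degree_one ((integerEquivAdicCompletionIntegers v).trans (padicIntEquivOfDegreeOne K 2 v he hf))
          hq heπ hPlt) (isLTSeries_LTCoeff _) 1) (constantCoeff_hom _ _ _ 1)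
      (evalPt₁ (maxNilIdeal (v.adicCompletion K)
        (E ⊔ ltField ((u : 𝒪[v.adicCompletion K]) * ((2 : ℕ) : 𝒪[v.adicCompletion K])) m :
          IntermediateField (v.adicCompletion K) (AlgebraicClosure (v.adicCompletion K))))
        (hom (isLTRing_LTCoeff (isUniformizer_unit_mul h2 u)) (isLTSeries_LTCoeff _) (isLTSeries_LTCoeff _)
          (LTCoeff.of (v.adicCompletion K) (a : 𝒪[v.adicCompletion K]))) (constantCoeff_hom _ _ _ _)
        (inclPt (le_sup_right : ltField _ m ≤ E ⊔ ltField _ m) (cohPt (isUniformizer_unit_mul h2 u) m))) :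
      (maxNilIdeal (v.adicCompletion K) (E ⊔ ltField ((u : 𝒪[v.adicCompletion K]) * ((2 : ℕ) : 𝒪[v.adicCompletion K])) m :
        IntermediateField (v.adicCompletion K) (AlgebraicClosure (v.adicCompletion K)))).toIdeal) :
      unitBall (E ⊔ ltField ((u : 𝒪[v.adicCompletion K]) * ((2 : ℕ) : 𝒪[v.adicCompletion K])) m :
        IntermediateField (v.adicCompletion K) (AlgebraicClosure (v.adicCompletion K)))) :
      (E ⊔ ltField ((u : 𝒪[v.adicCompletion K]) * ((2 : ℕ) : 𝒪[v.adicCompletion K])) m :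
        IntermediateField (v.adicCompletion K) (AlgebraicClosure (v.adicCompletion K)))) ≠ 0 := by
    intro m h0
    have h1 : U m = 0 := by rw [← ha' m, ptOfZ_of_eq_zero h0]
    have h3 := hord m
    rw [h1, addOrderOf_zero] at h3
    exact absurd h3.symm (ne_of_gt (one_lt_pow₀ one_lt_two (Nat.succ_ne_zero m)))
  refine ⟨a, fun j k => ?_⟩
  -- per unit: V1+V2 with that `a` gives (hβ), then (β) for a plain series
  have hβ := relColemanSeries_eq_subst_subst_of_semiconj (isUniformizer_unit_mul h2 u) E hq hE hσ₀ (β j) (G j)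
    (constantCoeff_hom _ _ _ 1) (constantCoeff_hom _ _ _ _) _ (fun m => hEll m) ψ𝔓 WR hWR ((S j).erase 0) (Kc j) x₀ y₀ (x j) (uc j)
    (hu j) (hG j) τ hτ hWτ (hKτ j) (eι j) (heT j) (hinj j) (hsurj j) (hxτ j) ht0 xR yR h₀ hR (fun m _ => by rw [ha' m]; exact hpt m)
    (hval j)
  have h := map_relCoatesWiles_eq_of_bridge_series K v he hf hq h2 u E hE hσ₀ (β j) k ρ φF hρ ιp V hP heπ
    (isLTSeries_map_LTCoeff_of_degree_one ((integerEquivAdicCompletionIntegers v).trans (padicIntEquivOfDegreeOne K 2 v he hf))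
      hq heπ hPlt) (LTCoeff.of (v.adicCompletion K) (a : 𝒪[v.adicCompletion K])) (G j) hβ WR x₀ y₀ (x j) (uc j) (Kc j) φC WC L
    (hS j) hg₂ hg₃ (hΩ j) hV ha hb (hK j) (hx j) (hu j) ψ𝔓 (hG j) hQθ hW
  rwa [RingEquiv.symm_apply_apply] at h

end Summit.BirchSwinnertonDyer.BirchSwinnertonDyer.Theorems.PrintCf2.KatzMeasureJZeroSeam

end
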